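import Summits.Ventures.QEC.Thresholds.RotatedSurfaceCodeSAWThresholdsZ
import Summits.Ventures.QEC.Thresholds.PlanarSurfaceCodeSAWInhomogeneous
import Literature.InformationTheory.QuantumCodes.RotatedSurfaceCodeCrossingPathsInhomogeneousZ
import HarnessLib
-- buildfix (bf3-g30) G30-25: comment-only touch to re-dispatch the lane build (dead-lettered rc 76 (att 7, last 20:24 08-27 / 06:01 08-28) behind Literature.InformationTheory.QuantumCodes.ToricCodeErasureHalfGeometry whose hub olean is fresh; root and file farm rc 0 now (lane datum: host-local stale dependency olean); no build event for 9-19 h); declarations byte-identical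

/-!
# Rotated surface codes `RSC(L)`, code capacity with INHOMOGENEOUS independent noise, `H_Z` sector (every size): every family
# of qubit-dependent rates `p_{i,v} ≤ ρ < p₀(2.6939)` (in particular `ρ ≤ .0357`) is below threshold — unconditional, KERNEL

Venture QEC, `Summits/Ventures/QEC/Thresholds/` (LADDER-QEC rung Q5, PARTITION row 09; qec-type-09 gen 6, cell item
«09.RSCINHZ»; the `H_Z`-sector twin of `RotatedSurfaceCodeSAWInhomogeneous.lean`, item 148, on top of the second lift
`RotatedSurfaceCodeSAWThresholdsZ.lean`, item 150). With `RotatedSurfaceCodeCrossingPathsInhomogeneousZ.lean` (the odd row-`0`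
residual bound for `indepWeight r`, rates `≤ ρ ≤ 1/2`):

| theorem | statement | tier |
|---|---|---|
| `rsc_x_inhom_belowThreshold_of_sawCountBound` | `cₙ ≤ C νⁿ`, rates `≤ ρ ≤ 1/2`, `4ν²ρ(1-ρ) < 1` ⇒ `Σ_{fails} w_r(e) → 0`, every minimum-weight decoder family of the `H_Z` sector | CERTIFIED (kernel), parametric |
| `rsc_x_inhom_belowThreshold_of_connectiveConstant_le` | `μ(ℤ²) ≤ μ'`, rates `≤ ρ < p₀(μ')` ⇒ `→ 0` | CERTIFIED (kernel), parametric |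
| ★ `rsc_x_inhom_belowThreshold_kernelSymmK16`, `rsc_x_inhom_belowThreshold_0357` | rates `≤ ρ < p₀(2.6939)`, resp. `≤ ρ ≤ .0357` ⇒ `→ 0` | CERTIFIED (kernel), unconditional |

Together with item 148 (`H_X` sector): BOTH sectors of every `RSC(L)` are below threshold under every inhomogeneous independent
noise with rates `≤ .0357`. HONEST FRAMING: failure-SUM statements (the rates vary with the qubit), not threshold VALUES;
certified at the kernel certificate `μ(ℤ²) ≤ 2.6939`. No `native_decide`, no named fact, axioms standard.

## References

* [DennisEtAl2002] E. Dennis, A. Kitaev, A. Landahl, J. Preskill, *Topological quantum memory*, J. Math. Phys. 43 (2002)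
  4452–4505, arXiv:quant-ph/0110143, §4.1 (independent errors), §5.3 eqs. (threshold_2d), (fail_2d).
* [PonitzTittmann2000] A. Pönitz, P. Tittmann, Electron. J. Combin. 7 (2000) R21, Table 2 (`d = 2, k = 16`: `2.6939`).
-/

noncomputable section

namespace Summit.Ventures.QEC.Thresholds

open Filter Topology Finset Matrix
open Literature.InformationTheory.QuantumCodes
open Literature.InformationTheory.QuantumCodes.RotatedSurface
open Literature.InformationTheory.QuantumCodes.ToricCode (SAWCountBound)
open Literature.Probability.RandomPlanarGeometry

open Classical in
/-- The inhomogeneous failure sum of a minimum-weight decoder of the `H_Z` sector of `RSC(L)` (`L ≥ 1`) is at most the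
inhomogeneous probability of an odd row-`0` residual. [cite: DennisEtAl2002, §5.2 (Prob_fail ≤ the probability of a non-trivial relative polygon)] -/
theorem rsc_x_inhom_failure_le_sum_oddResidual {L : ℕ} (hL : 0 < L)
    {D : Decoder (Fin (L - 1) × Fin (L + 1) → ZMod 2) (Fin L × Fin L → ZMod 2)}
    (hD : D.IsMinWeight (fun e => HZ L *ᵥ e) {x | HZ L *ᵥ x = 0} hammingNorm)
    {r : Fin L × Fin L → ℝ} (hr0 : ∀ v, 0 ≤ r v) (hr1 : ∀ v, r v ≤ 1) :
    (∑ e ∈ univ.filter (fun e : Fin L × Fin L → ZMod 2 =>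
        ¬ D.Corrects (fun e => HZ L *ᵥ e) ((RotatedSurface.code L).rowSpX : Set (Fin L × Fin L → ZMod 2)) e),
        indepWeight r (supp e)) ≤
      ∑ e ∈ univ.filter (fun e : Fin L × Fin L → ZMod 2 =>
        ∑ j : Fin L, (D (HZ L *ᵥ e) + e) (⟨0, hL⟩, j) = 1), indepWeight r (supp e) := by
  refine Finset.sum_le_sum_of_subset_of_nonneg (fun e he => ?_) fun e _ _ => indepWeight_nonneg hr0 hr1 _
  rw [Finset.mem_filter] at he ⊢
  exact ⟨Finset.mem_univ _, rsc_oddResidualZ_of_not_corrects hL hD he.2⟩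

open Classical in
/-- **Inhomogeneous noise below `4ν² ρ(1-ρ) < 1`** (given `cₙ ≤ C νⁿ`, `ν > 0`): for every minimum-weight decoder family of
the `H_Z` sector of the rotated surface codes and every family of qubit-dependent flip rates `0 ≤ p_{i,v} ≤ ρ ≤ 1/2`, the
failure probability tends to `0`. [cite: DennisEtAl2002, §5.3 eq. (threshold_2d)] -/
theorem rsc_x_inhom_belowThreshold_of_sawCountBound {C ν : ℝ} (hν : 0 < ν) (hC : SAWCountBound C ν)
    (D : ∀ i, Decoder (Fin (i + 1 - 1) × Fin (i + 1 + 1) → ZMod 2) (Fin (i + 1) × Fin (i + 1) → ZMod 2))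
    (hD : ∀ i, (D i).IsMinWeight (rscCode i).xSyndrome ((rscCode i).kerZ : Set _) hammingNorm)
    {rate : ∀ i, Fin (i + 1) × Fin (i + 1) → ℝ} {ρ : ℝ} (hr0 : ∀ i v, 0 ≤ rate i v) (hrρ : ∀ i v, rate i v ≤ ρ)
    (hρ0 : 0 ≤ ρ) (hρ : ρ ≤ 1 / 2) (h4 : 4 * ν ^ 2 * (ρ * (1 - ρ)) < 1) :
    Tendsto (fun i => ∑ e ∈ univ.filter (fun e : Fin (i + 1) × Fin (i + 1) → ZMod 2 =>
        ¬ (D i).Corrects (rscCode i).xSyndrome ((rscCode i).rowSpX : Set (Fin (i + 1) × Fin (i + 1) → ZMod 2)) e),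
        indepWeight (rate i) (supp e)) atTop (𝓝 0) := by
  have ht := rsc_tendsto_sum_indepWeight_oddResidualZ hν hC D hD hr0 hrρ hρ0 hρ h4
  have hr1 : ∀ i v, rate i v ≤ 1 := fun i v => (hrρ i v).trans (by linarith)
  refine squeeze_zero' (Filter.Eventually.of_forall fun i => ?_)
    (Filter.Eventually.of_forall fun i => rsc_x_inhom_failure_le_sum_oddResidual (by omega) (hD i) (hr0 i) (hr1 i)) ht
  exact Finset.sum_nonneg fun e _ => indepWeight_nonneg (hr0 i) (hr1 i) _

open Classical in
/-- **Inhomogeneous noise from any bound on the connective constant**: if `μ(ℤ²) ≤ μ'` (`μ' ≥ 1`) and all rates are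
`≤ ρ < p₀(μ')`, the failure probability of every minimum-weight decoder family of the `H_Z` sector tends to `0`.
[cite: DennisEtAl2002, §5.3 eqs. (saw_2), (threshold_2d)] -/
theorem rsc_x_inhom_belowThreshold_of_connectiveConstant_le {μ' : ℝ} (hμ'1 : 1 ≤ μ')
    (hμ : SAW.Zd.connectiveConstant 2 ≤ μ')
    (D : ∀ i, Decoder (Fin (i + 1 - 1) × Fin (i + 1 + 1) → ZMod 2) (Fin (i + 1) × Fin (i + 1) → ZMod 2))
    (hD : ∀ i, (D i).IsMinWeight (rscCode i).xSyndrome ((rscCode i).kerZ : Set _) hammingNorm)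
    {rate : ∀ i, Fin (i + 1) × Fin (i + 1) → ℝ} {ρ : ℝ} (hr0 : ∀ i v, 0 ≤ rate i v) (hrρ : ∀ i v, rate i v ≤ ρ)
    (hρ0 : 0 ≤ ρ) (hρ : ρ < thresholdValue μ') :
    Tendsto (fun i => ∑ e ∈ univ.filter (fun e : Fin (i + 1) × Fin (i + 1) → ZMod 2 =>
        ¬ (D i).Corrects (rscCode i).xSyndrome ((rscCode i).rowSpX : Set (Fin (i + 1) × Fin (i + 1) → ZMod 2)) e),
        indepWeight (rate i) (supp e)) atTop (𝓝 0) := by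
  obtain ⟨ν, hν, h4⟩ := exists_gt_four_mul_sq_lt_one_of_lt_thresholdValue hμ'1 hρ0 hρ
  obtain ⟨C, hC⟩ := exists_sawCountBound_of_connectiveConstant_lt (lt_of_le_of_lt hμ hν)
  exact rsc_x_inhom_belowThreshold_of_sawCountBound (by linarith) hC D hD hr0 hrρ hρ0
    (hρ.le.trans (thresholdValue_le_half μ')) h4

open Classical in
/-- ★ **Rotated surface codes are below threshold under EVERY inhomogeneous independent noise with rates `≤ ρ < p₀(2.6939)`**
(`H_Z` sector, every minimum-weight decoder family, every size) — UNCONDITIONAL, tier CERTIFIED (kernel).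
[cite: DennisEtAl2002, §5.3 eq. (threshold_2d)] [cite: PonitzTittmann2000, Table 2 (d = 2, k = 16)] -/
theorem rsc_x_inhom_belowThreshold_kernelSymmK16
    (D : ∀ i, Decoder (Fin (i + 1 - 1) × Fin (i + 1 + 1) → ZMod 2) (Fin (i + 1) × Fin (i + 1) → ZMod 2))
    (hD : ∀ i, (D i).IsMinWeight (rscCode i).xSyndrome ((rscCode i).kerZ : Set _) hammingNorm)
    {rate : ∀ i, Fin (i + 1) × Fin (i + 1) → ℝ} {ρ : ℝ} (hr0 : ∀ i v, 0 ≤ rate i v) (hrρ : ∀ i v, rate i v ≤ ρ)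
    (hρ0 : 0 ≤ ρ) (hρ : ρ < thresholdValue 2.6939) :
    Tendsto (fun i => ∑ e ∈ univ.filter (fun e : Fin (i + 1) × Fin (i + 1) → ZMod 2 =>
        ¬ (D i).Corrects (rscCode i).xSyndrome ((rscCode i).rowSpX : Set (Fin (i + 1) × Fin (i + 1) → ZMod 2)) e),
        indepWeight (rate i) (supp e)) atTop (𝓝 0) :=
  rsc_x_inhom_belowThreshold_of_connectiveConstant_le (by norm_num) SAW.Zd.connectiveConstant_two_le_26939 D hD hr0 hrρ hρ0 hρ

open Classical in
/-- Decimal form: **all rates `≤ ρ ≤ .0357` ⇒ failure probability `→ 0`** (rotated surface codes, `H_Z` sector, every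
minimum-weight decoder family) — UNCONDITIONAL, tier CERTIFIED (kernel). [cite: DennisEtAl2002, §5.3 eq. (p_c_2d)] -/
theorem rsc_x_inhom_belowThreshold_0357
    (D : ∀ i, Decoder (Fin (i + 1 - 1) × Fin (i + 1 + 1) → ZMod 2) (Fin (i + 1) × Fin (i + 1) → ZMod 2))
    (hD : ∀ i, (D i).IsMinWeight (rscCode i).xSyndrome ((rscCode i).kerZ : Set _) hammingNorm)
    {rate : ∀ i, Fin (i + 1) × Fin (i + 1) → ℝ} {ρ : ℝ} (hr0 : ∀ i v, 0 ≤ rate i v) (hrρ : ∀ i v, rate i v ≤ ρ)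
    (hρ0 : 0 ≤ ρ) (hρ : ρ ≤ 0.0357) :
    Tendsto (fun i => ∑ e ∈ univ.filter (fun e : Fin (i + 1) × Fin (i + 1) → ZMod 2 =>
        ¬ (D i).Corrects (rscCode i).xSyndrome ((rscCode i).rowSpX : Set (Fin (i + 1) × Fin (i + 1) → ZMod 2)) e),
        indepWeight (rate i) (supp e)) atTop (𝓝 0) :=
  rsc_x_inhom_belowThreshold_kernelSymmK16 D hD hr0 hrρ hρ0 (lt_of_le_of_lt hρ thresholdValue_26939_bounds.1)

end Summit.Ventures.QEC.Thresholds
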